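import Literature.AnabelianGeometry.AbsoluteAnabelian.GaloisPadicLogInstance
import Literature.AnabelianGeometry.AbsoluteAnabelian.GaloisPadicLogIntegers
import Summits.ABC.IUTFork.LanaLogShell
import Summits.ABC.IUTFork.LanaPadicGalois
import HarnessLib

/-!
# L-LANA objects VI bis: `log : O^{×μ}_v ⥲ K̄_v` REAL at the `ℚ_p` datum, and the printed log-shell `I_v` versus the (MF) log-shell

Record-only file (D-0012) of the abc-iut cell (seat abc-iut-c312-4, L-LANA level, plan/LLANA-SPEC N10 (HF)/(MF) and
N12 modelling note (ii) "the log-link's effect on Frobenius-like data … needs the `p`-adic logarithm … NOT typed");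
CONSUMES layer L4's REAL `p`-adic logarithm of `ℚ̄_p` (`Literature.NumberTheory.Transcendental.padicLogAlgCl`,
with the [AbsTopIII] Def. 3.1 (i) properties PROVED in `AbsoluteAnabelian/GaloisPadicLogInstance.lean`:
homomorphism on `O^×_{ℚ̄_p}`, `G_{ℚ_p}`-equivariant, kernel = roots of unity, onto `ℚ̄_p`; and the dictionary
`O^×_{ℚ̄_p} = {‖x‖ = 1}`, `GaloisPadicLogIntegers.lean`); TAKES NO SIDE on [IUTchIII] Cor. 3.12.

LANA §5.1 p. 26: "Let `v ∈ V^non`. Then the `p`-adic logarithm map gives an isomorphism of groups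
`log : O^{×μ}_v ⥲ K̄_v`. Using this, we define a `ℤ_p`-module `I_v`, called the log-shell at `v`, by
`I_v = (2p_v)⁻¹ · Im(O^×_v ↪ O^×_{K̄_v} ↠ O^{×μ}_v →^{log} K̄_v) ⊂ K̄_v`"; §5.1 (c) p. 27: "The group `O^{×μ}_v` is
isomorphic to the underlying additive group of the field `K̄_v`. The mono-analytic Frobenius-like log-shell at
`v` is … `I_v(F^{⊢×μ}) = (2p_v)⁻¹ · Im(I^κ_{G_v} ↪ O^{×μ}_v)`"; §5.3 (a) p. 29 / Fig. 2 p. 30: the log-link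
`log : †K̄_v(logF) ⥲ ‡K̄_v` joins `†O^{×μ}_v` to `‡K̄_v`.

THIS file, at the `ℚ_p` reference datum of `LanaPadicGalois.lean` / `LanaGoodPlace.lean` (`K̄_v = ℚ̄_p = PadicAlgCl p`,
`| · | = padicVal p`, `G_v = Gal(ℚ̄_p/ℚ_p)`; LANA's `O^×`, `O^μ`, `O^{×μ}`, `I^κ_H` from `LanaLocalUnits.lean`):

* `padicLogUnits : O^×_{ℚ̄_p} →* (ℚ̄_p, +)` (the REAL logarithm on the valuation-one units), its kernel
  `= O^μ` (`ker_padicLogUnits`), its surjectivity;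
* **`padicLogIso : O^{×μ}_{ℚ̄_p} ≃* (ℚ̄_p, +)` — LANA's "isomorphism of groups `log : O^{×μ}_v ⥲ K̄_v`", REAL**
  (DEFINED from the four proved properties; `padicLogIso_mk`), and `G_{ℚ_p}`-EQUIVARIANT (`padicLogIso_smul`) —
  this is the Frobenius-side map of the log-link at this datum (LanaLogTheta modelling note (ii), retired here);
* **`printedLogShell`** — `I_v := (2p)⁻¹ · log((O^×_{ℚ̄_p})^{G_{ℚ_p}}) ⊂ ℚ̄_p` EXACTLY as displayed on p. 26, and
  **`padicLogIso_mem_printedLogShell_iff` (PROVED)**: `log` carries gen 0's multiplicative (MF) log-shell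
  `logShellMF = {y ∈ O^{×μ} | y^{2p} ∈ I^κ_{G_v}}` (`LanaLogShell.lean`: "(2p_v)⁻¹ · X" in the uniquely divisible
  group `O^{×μ}` = the `2p`-th roots of `X`) ONTO the printed additive `I_v` — the (MF) shell and the p. 26 shell are
  ONE object under the p. 26 isomorphism (`map_logShellMF_eq`).

HONEST SCOPE. (i) Only the `ℚ_p` datum (`K_v = ℚ_p`): the general `K_v` needs the logarithm of `K̄_v` for an
arbitrary MLF closure — L4's `MLFClosure.logEquiv` (`GaloisPadicLogMLF.lean`) supplies it over the integral-closure
units `unitGroup C.k C.K`; the dictionary with LANA's valuation-one units of `LanaLocalField.AlgCl K_v` is not built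
here. (ii) The field structure "`K̄_v(logF)`" on `O^{×μ}` (§5.1 (a), [AbsTopIII] Prop. 3.2 (iii)/(v)) is the
transport of structure along `padicLogIso` and is not given a separate name. (iii) The comparison of `I_v ∩ ℚ_p`
with gen 2's finite-level `logShellHF p ℚ_p` (S1's `unitLog`) is not made here. [cite: LANA2026Report, §5.1 pp. 26–27,
§5.3 (a) p. 29] [cite: MochizukiAbsTopIII2015, Definition 3.1 (i) p.66] NOT here: any judgement.
-/

noncomputable section

namespace Summit.ABC
namespace IUTFork

open Literature.AnabelianGeometry.AbsoluteAnabelian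
open Literature.NumberTheory.Transcendental (padicLogAlgCl)
open scoped NNReal

variable (p : ℕ) [Fact p.Prime]

/-! ## 1. The valuation-one units of `ℚ̄_p` are L4's `O^×_{ℚ̄_p}` -/

/-- LANA's `O^×_{ℚ̄_p} = {|u| = 1}` (valuation `padicVal p`) consists of elements of norm `1`. [cite: LANA2026Report, §0.4 (b) p. 8] -/
theorem norm_eq_one_of_mem_unitGrp (u : unitGrp (padicVal p)) : ‖((u : (PadicAlgCl p)ˣ) : PadicAlgCl p)‖ = 1 := by
  have h : Valued.v ((u : (PadicAlgCl p)ˣ) : PadicAlgCl p) = 1 := u.2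
  rw [PadicAlgCl.valuation_def] at h
  rw [← coe_nnnorm, h, NNReal.coe_one]

/-- … hence lies in L4's integral-closure unit monoid `𝒪^×_{ℚ̄_p}` ([AbsTopIII] Def. 3.1 (i); dictionary
`PadicAlgCl.mem_unitSubmonoid_iff`). [cite: MochizukiAbsTopIII2015, Definition 3.1 (i) p.66] -/
theorem coe_unitGrp_mem_unitSubmonoid (u : unitGrp (padicVal p)) :
    ((u : (PadicAlgCl p)ˣ) : PadicAlgCl p) ∈ unitSubmonoid ℚ_[p] (PadicAlgCl p) :=
  (PadicAlgCl.mem_unitSubmonoid_iff _).mpr (norm_eq_one_of_mem_unitGrp p u)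

/-- Conversely an element of norm `1` is a valuation-one unit. [cite: LANA2026Report, §0.4 (b) p. 8] -/
theorem mem_unitGrp_of_norm_eq_one {x : PadicAlgCl p} (hx : ‖x‖ = 1) :
    Units.mk0 x (norm_ne_zero_iff.mp (by rw [hx]; exact one_ne_zero)) ∈ unitGrp (padicVal p) := by
  rw [mem_unitGrp_iff, Units.val_mk0]
  change Valued.v x = 1
  rw [PadicAlgCl.valuation_def, ← NNReal.coe_eq_one, coe_nnnorm, hx]

/-! ## 2. `log : O^×_{ℚ̄_p} → ℚ̄_p`, its kernel `O^μ`, and the isomorphism `O^{×μ} ⥲ ℚ̄_p` (p. 26) -/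

/-- **The `p`-adic logarithm on `O^×_{ℚ̄_p}`** as a homomorphism to `(ℚ̄_p, +)` (L4's REAL `padicLogAlgCl`, a
homomorphism on `𝒪^×` by `PadicAlgCl.log_mul_of_mem_unitSubmonoid`). [cite: LANA2026Report, §5.1 p. 26] -/
def padicLogUnits : unitGrp (padicVal p) →* Multiplicative (PadicAlgCl p) where
  toFun u := Multiplicative.ofAdd (padicLogAlgCl p ((u : (PadicAlgCl p)ˣ) : PadicAlgCl p))
  map_one' := by
    have h1 : padicLogAlgCl p (1 * 1 : PadicAlgCl p) = padicLogAlgCl p 1 + padicLogAlgCl p 1 :=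
      PadicAlgCl.log_mul_of_mem_unitSubmonoid p (Submonoid.one_mem _) (Submonoid.one_mem _)
    rw [mul_one] at h1
    have h0 : padicLogAlgCl p (1 : PadicAlgCl p) = 0 := by linear_combination -h1
    change Multiplicative.ofAdd (padicLogAlgCl p 1) = 1
    rw [h0]; rfl
  map_mul' u v := by
    change Multiplicative.ofAdd
        (padicLogAlgCl p (((u : (PadicAlgCl p)ˣ) : PadicAlgCl p) * ((v : (PadicAlgCl p)ˣ) : PadicAlgCl p))) = _
    rw [PadicAlgCl.log_mul_of_mem_unitSubmonoid p (coe_unitGrp_mem_unitSubmonoid p u)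
      (coe_unitGrp_mem_unitSubmonoid p v), ofAdd_add]

/-- `log` on a unit, unfolded. [cite: LANA2026Report, §5.1 p. 26] -/
@[simp] theorem padicLogUnits_apply (u : unitGrp (padicVal p)) :
    padicLogUnits p u = Multiplicative.ofAdd (padicLogAlgCl p ((u : (PadicAlgCl p)ˣ) : PadicAlgCl p)) := rfl

/-- **`Ker(log) = O^μ`**: the logarithm of a unit vanishes iff the unit is a root of unity (L4's
`log_eq_zero_iff_of_mem_unitSubmonoid`; LANA §3.6 "`O^μ_v := (O^×_v)_{tor}`"). [cite: LANA2026Report, §3.6 p. 20, §5.1 p. 26] -/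
theorem ker_padicLogUnits : (padicLogUnits p).ker = torsionUnits (padicVal p) := by
  ext u
  rw [MonoidHom.mem_ker, padicLogUnits_apply, CommGroup.mem_torsion, isOfFinOrder_iff_pow_eq_one]
  change Multiplicative.ofAdd _ = Multiplicative.ofAdd 0 ↔ _
  rw [Multiplicative.ofAdd.injective.eq_iff,
    PadicAlgCl.log_eq_zero_iff_of_mem_unitSubmonoid p (coe_unitGrp_mem_unitSubmonoid p u)]
  refine exists_congr fun n => and_congr_right fun _ => ?_
  rw [← Units.val_pow_eq_pow_val, ← Units.val_one, Units.val_inj, ← Subgroup.coe_pow, ← Subgroup.coe_one,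
    Subtype.coe_inj]

/-- **`log : O^×_{ℚ̄_p} ↠ ℚ̄_p` is onto** (L4's `log_surjective_unitSubmonoid`). [cite: LANA2026Report, §5.1 p. 26] -/
theorem padicLogUnits_surjective : Function.Surjective (padicLogUnits p) := by
  intro y
  obtain ⟨x, hx, hxy⟩ := PadicAlgCl.log_surjective_unitSubmonoid p (Multiplicative.toAdd y)
  have hx1 : ‖x‖ = 1 := (PadicAlgCl.mem_unitSubmonoid_iff x).mp hx
  refine ⟨⟨_, mem_unitGrp_of_norm_eq_one p hx1⟩, ?_⟩
  rw [padicLogUnits_apply]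
  change Multiplicative.ofAdd (padicLogAlgCl p x) = y
  rw [hxy, ofAdd_toAdd]

/-- **LANA p. 26, REAL: "the `p`-adic logarithm map gives an isomorphism of groups `log : O^{×μ}_v ⥲ K̄_v`"** — at the
`ℚ_p` datum, `O^{×μ}_{ℚ̄_p} = O^×/O^μ ⥲ (ℚ̄_p, +)` induced by `log` (kernel `O^μ`, onto). This is also the
Frobenius-side map of the log-link `log : †K̄_v(logF) ⥲ ‡K̄_v` (§5.3 (a), Fig. 2) at this datum.
[cite: LANA2026Report, §5.1 p. 26, §5.3 (a) p. 29] -/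
def padicLogIso : UnitsModTorsion (padicVal p) ≃* Multiplicative (PadicAlgCl p) :=
  (QuotientGroup.quotientMulEquivOfEq (ker_padicLogUnits p).symm).trans
    (QuotientGroup.quotientKerEquivOfSurjective (padicLogUnits p) (padicLogUnits_surjective p))

/-- On the class of a unit `u`, the isomorphism is `log u`. [cite: LANA2026Report, §5.1 p. 26] -/
@[simp] theorem padicLogIso_mk (u : unitGrp (padicVal p)) :
    padicLogIso p (u : UnitsModTorsion (padicVal p)) =
      Multiplicative.ofAdd (padicLogAlgCl p ((u : (PadicAlgCl p)ˣ) : PadicAlgCl p)) := rfl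

/-- **`G_{ℚ_p}`-equivariance of `log : O^{×μ} ⥲ ℚ̄_p`**: `log(σ·y) = σ(log y)` (L4's `log_smul_of_mem_unitSubmonoid`;
LANA §3.6: `G_v ↷ O^{×μ}_v` is the descended action). [cite: LANA2026Report, §3.6 p. 20, §5.1 p. 26] -/
theorem padicLogIso_smul (σ : PadicGal p) (y : UnitsModTorsion (padicVal p)) :
    Multiplicative.toAdd (padicLogIso p (σ • y)) = σ (Multiplicative.toAdd (padicLogIso p y)) := by
  induction y using QuotientGroup.induction_on with
  | H u =>
    rw [UnitsModTorsion.smul_mk, padicLogIso_mk, padicLogIso_mk, toAdd_ofAdd, toAdd_ofAdd, unitGrp.coe_smul,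
      PadicAlgCl.log_smul_of_mem_unitSubmonoid p σ (coe_unitGrp_mem_unitSubmonoid p u), AlgEquiv.smul_def]

/-! ## 3. The printed log-shell `I_v` (p. 26) and the (MF) log-shell under `log` -/

/-- **LANA p. 26, as displayed: `I_v := (2p_v)⁻¹ · Im(O^×_v ↪ O^×_{K̄_v} ↠ O^{×μ}_v →^{log} K̄_v) ⊂ K̄_v`** at the
`ℚ_p` datum — the additive subgroup of `y ∈ ℚ̄_p` with `2p · y = log u` for some `G_{ℚ_p}`-invariant unit
`u ∈ O^×_v = (O^×_{ℚ̄_p})^{G_{ℚ_p}}` (§3.9 "`O^×_v := (O^×_{K̄_v})^{G_v}`"). [cite: LANA2026Report, §5.1 p. 26] -/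
def printedLogShell : AddSubgroup (PadicAlgCl p) where
  carrier := {y | ∃ u ∈ unitInv (padicVal p) (PadicGal p),
    ((2 * p : ℕ) : PadicAlgCl p) * y = padicLogAlgCl p ((u : (PadicAlgCl p)ˣ) : PadicAlgCl p)}
  zero_mem' := ⟨1, Subgroup.one_mem _, by
    rw [mul_zero]
    exact (congrArg Multiplicative.toAdd (map_one (padicLogUnits p))).symm⟩
  add_mem' := by
    rintro a b ⟨u, hu, hau⟩ ⟨v, hv, hbv⟩
    refine ⟨u * v, Subgroup.mul_mem _ hu hv, ?_⟩
    have h := congrArg Multiplicative.toAdd (map_mul (padicLogUnits p) u v)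
    rw [padicLogUnits_apply, padicLogUnits_apply, padicLogUnits_apply, toAdd_ofAdd, toAdd_mul, toAdd_ofAdd,
      toAdd_ofAdd] at h
    rw [mul_add, hau, hbv, ← h]
  neg_mem' := by
    rintro a ⟨u, hu, hau⟩
    refine ⟨u⁻¹, Subgroup.inv_mem _ hu, ?_⟩
    have h := congrArg Multiplicative.toAdd (map_inv (padicLogUnits p) u)
    rw [padicLogUnits_apply, padicLogUnits_apply, toAdd_ofAdd, toAdd_inv, toAdd_ofAdd] at h
    rw [mul_neg, hau, ← h]

/-- Membership in the printed `I_v`. [cite: LANA2026Report, §5.1 p. 26] -/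
theorem mem_printedLogShell_iff (y : PadicAlgCl p) :
    y ∈ printedLogShell p ↔ ∃ u ∈ unitInv (padicVal p) (PadicGal p),
      ((2 * p : ℕ) : PadicAlgCl p) * y = padicLogAlgCl p ((u : (PadicAlgCl p)ˣ) : PadicAlgCl p) :=
  Iff.rfl

/-- `2p ≠ 0` in `ℚ̄_p` (characteristic `0`). [folklore] -/
theorem two_mul_p_ne_zero : ((2 * p : ℕ) : PadicAlgCl p) ≠ 0 := by
  haveI : CharZero (PadicAlgCl p) := charZero_of_injective_algebraMap (algebraMap ℚ_[p] (PadicAlgCl p)).injective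
  exact_mod_cast (Nat.mul_ne_zero_iff.mpr ⟨two_ne_zero, (Fact.out : p.Prime).ne_zero⟩)

/-- `log` of a power of a class: `log(y^n) = n · log y`. [cite: LANA2026Report, §5.1 p. 26] -/
theorem toAdd_padicLogIso_pow (y : UnitsModTorsion (padicVal p)) (n : ℕ) :
    Multiplicative.toAdd (padicLogIso p (y ^ n)) = (n : PadicAlgCl p) * Multiplicative.toAdd (padicLogIso p y) := by
  rw [map_pow, toAdd_pow, nsmul_eq_mul]

/-- **The (MF) log-shell IS the printed log-shell under `log` (PROVED)**: for `y ∈ O^{×μ}_{ℚ̄_p}`,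
`log y ∈ I_v ⟺ y ∈ I_v(F^{⊢×μ})` — gen 0's multiplicative reading of "(2p_v)⁻¹ · Im(I^κ_{G_v} ↪ O^{×μ}_v)" (§5.1 (c):
the `2p`-th roots of `I^κ_{G_v}` in the uniquely divisible group `O^{×μ}`, `logShellMF`) and the additive display of
p. 26 agree under the p. 26 isomorphism. [cite: LANA2026Report, §5.1 p. 26, §5.1 (c) p. 27] -/
theorem padicLogIso_mem_printedLogShell_iff (y : UnitsModTorsion (padicVal p)) :
    Multiplicative.toAdd (padicLogIso p y) ∈ printedLogShell p ↔ y ∈ logShellMF (padicVal p) (PadicGal p) p := by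
  rw [mem_logShellMF_iff, mem_kummerStructure_iff, mem_printedLogShell_iff]
  constructor
  · rintro ⟨u, hu, h⟩
    refine ⟨u, hu, ?_⟩
    -- `log (y^{2p}) = 2p · log y = log u`, and `log` is injective on `O^{×μ}`
    apply (padicLogIso p).injective
    apply Multiplicative.toAdd.injective
    rw [toAdd_padicLogIso_pow, h, padicLogIso_mk, toAdd_ofAdd]
  · rintro ⟨u, hu, h⟩
    refine ⟨u, hu, ?_⟩
    rw [← toAdd_padicLogIso_pow, ← h, padicLogIso_mk, toAdd_ofAdd]

/-- Set-level form: **`log(I_v(F^{⊢×μ})) = I_v`** — the image of the (MF) log-shell under `log : O^{×μ} ⥲ ℚ̄_p` is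
exactly the printed log-shell. [cite: LANA2026Report, §5.1 p. 26, §5.1 (c) p. 27] -/
theorem map_logShellMF_eq :
    (fun y => Multiplicative.toAdd (padicLogIso p y)) '' (logShellMF (padicVal p) (PadicGal p) p : Set _) =
      (printedLogShell p : Set (PadicAlgCl p)) := by
  ext z
  constructor
  · rintro ⟨y, hy, rfl⟩
    exact (padicLogIso_mem_printedLogShell_iff p y).mpr hy
  · intro hz
    obtain ⟨y, hy⟩ := (padicLogIso p).surjective (Multiplicative.ofAdd z)
    refine ⟨y, ?_, ?_⟩
    · rw [SetLike.mem_coe, ← padicLogIso_mem_printedLogShell_iff, hy, toAdd_ofAdd]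
      exact hz
    · change Multiplicative.toAdd (padicLogIso p y) = z
      rw [hy, toAdd_ofAdd]

/-- The printed `I_v` is `G_{ℚ_p}`-stable (it is cut out by invariant units and `log` is equivariant) — the
additive counterpart of gen 0's `logShellMF_G_stable`. [cite: LANA2026Report, §5.1 p. 26] -/
theorem printedLogShell_smul_mem (σ : PadicGal p) {z : PadicAlgCl p} (hz : z ∈ printedLogShell p) :
    σ z ∈ printedLogShell p := by
  obtain ⟨y, hy⟩ := (padicLogIso p).surjective (Multiplicative.ofAdd z)
  have hyz : Multiplicative.toAdd (padicLogIso p y) = z := by rw [hy, toAdd_ofAdd]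
  have hy' : y ∈ logShellMF (padicVal p) (PadicGal p) p := by
    rw [← padicLogIso_mem_printedLogShell_iff, hyz]; exact hz
  have h := (padicLogIso_mem_printedLogShell_iff p (σ • y)).mpr (logShellMF_G_stable _ _ p σ hy')
  rwa [padicLogIso_smul, hyz] at h

end IUTFork

end Summit.ABC

end
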